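import Literature.AlgebraicGeometry.GroupSchemes.HopfIdealClosedSubgroup
import Literature.AlgebraicGeometry.GroupSchemes.AdmissibleIdealTransport
import Literature.AlgebraicGeometry.GroupSchemes.AffineGroupSchemeBialgHom
import HarnessLib

/-!
# The closed subscheme `V(Γ(φ)⁻¹ I) ↪ G′` is `V(I) ↪ G` followed by the isomorphism `φ : G ⥲ G′`; kills transport to ANY target
# ([GortzWedhorn2023] (27.1.1), §(27.2); [Waterhouse1979] §2.1)

For an isomorphism `φ : G ≅ G′` of affine `R`-schemes and an ideal `I ⊂ Γ(G)`, the closed immersion `quotIncl G′ (Γ(φ)⁻¹ I)` (★ `quotIncl`)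
FACTORS as `e ≫ quotIncl G I ≫ φ` for a (unique) `e : Spec (Γ(G′) ⧸ Γ(φ)⁻¹ I) → Spec (Γ(G) ⧸ I)` over `R` (★ factorisation criterion
`exists_comp_quotIncl_eq_iff_le_ker`, ★ `ptEquiv_comp`, ★ `ptEquiv_quotIncl`, ★ `appTop_hom_appTop_inv_apply`).  CONSEQUENCE (the point of the file):
for a morphism `ψ : G′ → X` into ANY monoid object `X` over `R` (not necessarily affine — an abelian scheme in the cell's use), if `ψ` kills `V(I)`
through `φ` (`quotIncl G I ≫ φ ≫ ψ = 1`) then `ψ` kills `V(Γ(φ)⁻¹ I)` (`quotIncl G′ (Γ(φ)⁻¹ I) ≫ ψ = 1`).  This is the affine-target-free half of ★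
(G1) `quotIncl_comap_comp_eq_one_iff` (p847826, which needs `X` affine for the augmentation-ideal criterion); the cell (hodgecm-mathlib, P6 «MOD», crux
hLiu418 = stmt-HodgeConjecture-24832, organ `stub_SPEC` (ρ1) KILL step) moves «the reduced roof kills `V(spI (I_L))` on the layer `A[𝔭]_κ̄`» along the dock
identification `ε : A[𝔭]_κ̄ ⥲ G₀` to «it kills `V(spGeoOf y L)` on the dock», the target being the special fibre of an abelian scheme.  THEOREMS ONLY
(no definition, no instance, no notation, no named fact, no `sorry`); `--supports stmt-HodgeConjecture-24832`, count-neutral.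

## References
* [GortzWedhorn2023] U. Görtz, T. Wedhorn, *Algebraic Geometry II*, (27.1.1) and §(27.2) (pp. 606–607) (closed subschemes of affine schemes and ideals; transport along isomorphisms).
* [Waterhouse1979] W. C. Waterhouse, *Introduction to Affine Group Schemes*, GTM 66 (1979), §2.1 (p. 14) (closed subschemes cut out by ideals; the trivial morphism).
-/

set_option autoImplicit false

set_option backward.isDefEq.respectTransparency false

universe u

open CategoryTheory CategoryTheory.Limits AlgebraicGeometry MonoidalCategory CartesianMonoidalCategory

noncomputable section

namespace Literature.AlgebraicGeometry.GroupSchemes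

namespace AffineGroupScheme

open scoped MonObj CategoryTheory.Obj

open Literature.AlgebraicGeometry.Motives AdmIdealTransport

variable {R : Type u} [CommRing R] {G G' : SchemeOver R} [IsAffine G.left] [IsAffine G'.left] (φ : G ≅ G') (I : Ideal (Alg G))

/-- **`V(Γ(φ)⁻¹ I) ↪ G′ ≫ φ⁻¹` LANDS IN `V(I)`**: the ideal `I` dies under the algebra map of `quotIncl G′ (Γ(φ)⁻¹ I) ≫ φ⁻¹`
(`a ↦ Γ(φ⁻¹) a mod Γ(φ)⁻¹ I`, and `Γ(φ)(Γ(φ⁻¹) a) = a ∈ I`). [cite: GortzWedhorn2023, (27.1.1) and §(27.2) (p. 607)] -/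
theorem le_ker_ptEquiv_quotIncl_comap_comp_inv :
    I ≤ RingHom.ker (ptEquiv G (Alg G' ⧸ (I.comap φ.hom.left.appTop.hom : Ideal (Alg G')))
      (quotIncl G' (I.comap φ.hom.left.appTop.hom : Ideal (Alg G')) ≫ φ.inv)).toRingHom := by
  intro a ha
  rw [RingHom.mem_ker, AlgHom.toRingHom_eq_coe, AlgHom.coe_toRingHom, ptEquiv_comp, AlgHom.comp_apply, ptEquiv_quotIncl,
    Ideal.Quotient.mkₐ_eq_mk, Ideal.Quotient.eq_zero_iff_mem, Ideal.mem_comap]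
  exact Eq.subst (motive := fun z => z ∈ I) (appTop_hom_appTop_inv_apply φ a).symm ha

/-- **FACTORISATION**: `quotIncl G′ (Γ(φ)⁻¹ I) = e ≫ quotIncl G I ≫ φ` for some `e : Spec (Γ(G′) ⧸ Γ(φ)⁻¹ I) → Spec (Γ(G) ⧸ I)` over `R`
(★ `exists_comp_quotIncl_eq_iff_le_ker` applied to `quotIncl G′ (Γ(φ)⁻¹ I) ≫ φ⁻¹`). [cite: GortzWedhorn2023, (27.1.1) and §(27.2) (p. 607)] -/
theorem exists_quotIncl_comap_eq_comp :
    ∃ e : Motives.specOver R (Alg G' ⧸ (I.comap φ.hom.left.appTop.hom : Ideal (Alg G'))) ⟶ Motives.specOver R (Alg G ⧸ I),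
      quotIncl G' (I.comap φ.hom.left.appTop.hom : Ideal (Alg G')) = e ≫ quotIncl G I ≫ φ.hom := by
  obtain ⟨e, he⟩ := (exists_comp_quotIncl_eq_iff_le_ker G I _).mpr (le_ker_ptEquiv_quotIncl_comap_comp_inv φ I)
  refine ⟨e, ?_⟩
  rw [← Category.assoc, he, Category.assoc, Iso.inv_hom_id, Category.comp_id]

/-- **HEAD — KILLS TRANSPORT ALONG AN ISOMORPHISM, ANY TARGET**: for `ψ : G′ → X` into a monoid object `X` over `R` (affine or not), if
`quotIncl G I ≫ φ ≫ ψ = 1` then `quotIncl G′ (Γ(φ)⁻¹ I) ≫ ψ = 1`. [cite: Waterhouse1979, §2.1 (p. 14)] [cite: GortzWedhorn2023, (27.1.1) and §(27.2) (p. 607)] -/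
theorem quotIncl_comap_comp_eq_one_of_comp_eq_one {X : SchemeOver R} [MonObj X] (ψ : G' ⟶ X)
    (h : quotIncl G I ≫ φ.hom ≫ ψ = 1) :
    quotIncl G' (I.comap φ.hom.left.appTop.hom : Ideal (Alg G')) ≫ ψ = 1 := by
  obtain ⟨e, he⟩ := exists_quotIncl_comap_eq_comp φ I
  rw [he, Category.assoc, Category.assoc, h, MonObj.comp_one]

/-- The same along `φ⁻¹`: if `quotIncl G′ I′ ≫ φ⁻¹ ≫ ψ = 1` then `quotIncl G (Γ(φ⁻¹)⁻¹ I′) ≫ ψ = 1` (`ψ : G → X`).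
[cite: Waterhouse1979, §2.1 (p. 14)] -/
theorem quotIncl_comap_inv_comp_eq_one_of_comp_eq_one {X : SchemeOver R} [MonObj X] (I' : Ideal (Alg G')) (ψ : G ⟶ X)
    (h : quotIncl G' I' ≫ φ.inv ≫ ψ = 1) :
    quotIncl G (I'.comap φ.inv.left.appTop.hom : Ideal (Alg G)) ≫ ψ = 1 :=
  quotIncl_comap_comp_eq_one_of_comp_eq_one φ.symm I' ψ h

/-- **IFF FORM** (both directions along the isomorphism; `Γ(φ⁻¹)⁻¹ (Γ(φ)⁻¹ I) = I`, ★ `comap_appTop_inv_comap_appTop_hom`).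
[cite: Waterhouse1979, §2.1 (p. 14)] [cite: GortzWedhorn2023, (27.1.1) and §(27.2) (p. 607)] -/
theorem quotIncl_comap_comp_eq_one_iff_of_iso {X : SchemeOver R} [MonObj X] (ψ : G' ⟶ X) :
    quotIncl G' (I.comap φ.hom.left.appTop.hom : Ideal (Alg G')) ≫ ψ = 1 ↔ quotIncl G I ≫ φ.hom ≫ ψ = 1 := by
  refine ⟨fun h => ?_, quotIncl_comap_comp_eq_one_of_comp_eq_one φ I ψ⟩
  have h' := quotIncl_comap_inv_comp_eq_one_of_comp_eq_one φ (I.comap φ.hom.left.appTop.hom : Ideal (Alg G')) (φ.hom ≫ ψ)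
    (by rw [Iso.inv_hom_id_assoc]; exact h)
  rw [comap_appTop_inv_comap_appTop_hom] at h'
  exact h'

end AffineGroupScheme

end Literature.AlgebraicGeometry.GroupSchemes

end
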